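import Summits.BirchSwinnertonDyer.Rank1Residual.X4.KuriharaLevelLowering
import Summits.BirchSwinnertonDyer.Rank1Residual.X4.KuriharaLevelLoweringTwist
import Literature.NumberTheory.EllipticCurves.PAdicLFunctionMinus
import HarnessLib

/-!
# Level lowering kills Kurihara numbers mod `p`, part 5: transport along the twist from ANY `V`-side function (the MINUS symbol at `p ≡ 3 (mod 4)`, in particular `p = 3`), and the Kurihara numbers of `W` as twisted sums on `V` (cell `b2b-bsdres`, seat additive-p4, line V40)

HONEST FRAMING (verbatim, cell `b2b-bsdres`): the goal of the cell is to DELETE the COMBINATION-SHAPED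
residual classes for ALL analytic-rank `≤ 1` curves over `ℚ` — "full BSD formula for every rank `≤ 1`
curve in class `C`" assembled STRICTLY from published theorems — so that the rank-`≤ 1` remainder
becomes exactly the CONSTRUCTION-SHAPED classes, which are TYPED (missing-input Props), NOT attempted;
this is not "finishing BSD". This file: research-route KERNEL THEOREMS (pure algebra over the tree's
`ratPlusSymbol` / `ratMinusSymbol` / `kuriharaNumber` / `PlusSymbolLevelLowersAt`; no named fact, no
conjecture, no definition, nothing booked; class X4 stays CONSTRUCTION-SHAPED).

## What is proved

Part 4 (`KuriharaLevelLoweringTwist`) transported the certificate `PlusSymbolLevelLowersAt W p f_W ℓ`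
from an `ℓ`-old identity for the PLUS symbol of `f_V` (the case `W = V ⊗ χ_p`, `p ≡ 1 (mod 4)`, where
`[r]⁺_{f_W} = c·∑_u (u/p)[r + u/p]⁺_{f_V}`). At `p ≡ 3 (mod 4)` — in particular on the whole `p = 3`
block N11 of the cell — the character `χ_{p*}` is ODD and the plus symbol of `f_W` is a twisted sum of
the MINUS symbol of `f_V` (tree `ModularForms.plusSymbol_charTwist_of_odd`,
`ModularForms.exists_rat_forall_ratPlusSymbol_charTwist_eq_of_odd`:
`[r]⁺_{f_W} = c·∑_u (u/p)[r + u/p]⁻_{f_V}`). So this part states the transport for an ARBITRARY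
`V`-side function `φ : ℚ → ℤ/p` (§1, `plusSymbolLevelLowersAt_of_twistSum_fn`: same proof as part 4
§2), specialises it to the reduced minus symbol of `f_V` with the Legendre character (§2,
`plusSymbolLevelLowersAt_of_legendreTwist_minus`: the `p ≡ 3 (mod 4)` twin of part 4 §3), and records
the INSTRUMENT LEMMA (§3, `kuriharaNumber_eq_twistSum`): under the mod-`p` twist identity every mod-`p`
Kurihara number of `f_W` is `c` times a twisted Kurihara sum of `φ` — i.e. the Kurihara numbers of the
additive curve `W` are computed from the modular symbol of `V` at level `N_V = N_W/p²` (cell (G, e = 2))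
or `N_W/p` (cell (M)) — the E2-AT3 / KURX instruments of the n1011 lane at `p = 3` can run `p²` times
lower.

Where the hypotheses come from (not asserted): as in part 4 — the twist identity with one `p`-integral
constant (tree theorems + Pal-type period bookkeeping; per pair the instrument reads `c = ±1`), the
`V`-side `ℓ`-old identity = Ribet + mod-`p` multiplicity one, a per-pair certificate computed by the
cell instrument `twist40.gp` (EVIDENCE: 738g1 @ 3 via `V` = its `−3`-twist of conductor 246,
`w = 2 ≡ −1`, `χ(2) = −1`, HOLDS; 1150e1 @ 5 via conductor 46 at level 23, HOLDS), never a fact.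

## References

* B. Mazur, J. Tate, J. Teitelbaum, Invent. Math. 84 (1986), §I.4 (4.2), §I.8. [cite: MazurTateTeitelbaum1986Invent, §I.4 (4.2) and §I.8]
* C.-H. Kim, Amer. J. Math. 148 (2026), §1.2.2, §1.4.3, Conj. 1.10. [cite: Kim2022StructureSelmer, §1.2.2 and §1.4.3]
* G. Shimura, *Introduction to the arithmetic theory of automorphic functions* (1971), Prop. 3.64.
-/

noncomputable section

open scoped MatrixGroups ModularForm

open CongruenceSubgroup Finset

open Literature.NumberTheory.EllipticCurves Literature.NumberTheory.EllipticCurves.ModularForms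

namespace Summit.BirchSwinnertonDyer.Rank1Residual.LevelLowering

/-! ### §1 Transport from an arbitrary `V`-side function -/

section TransportFn

variable (W : WeierstrassCurve ℚ) [W.IsGloballyMinimal] (p : ℕ) [Fact p.Prime]
  {m : ℕ} [NeZero m] (χ : ZMod m →* ZMod p) {NW : ℕ} (fW : CuspForm (Gamma0 NW) 2)

/-- A Hecke relation survives multiplication of the function by a constant. [folklore] -/
private theorem heckeRel_const_mul' {R : Type*} [CommRing R] {ν : ℚ → R} {q : ℕ} {a : R}
    (h : HeckeRel ν q a) (c : R) : HeckeRel (fun r ↦ c * ν r) q a := by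
  intro r
  have := congrArg (fun x ↦ c * x) (h r)
  simp only [mul_add, Finset.mul_sum] at this
  simp only
  rw [this]
  ring

/-- **TRANSPORT OF THE CERTIFICATE FROM ANY `V`-SIDE FUNCTION.** If the mod-`p` plus symbol of `f_W`
is `c` times the `χ`-twisted sum of a function `φ : ℚ → ℤ/p` (`hsym`), `φ = μ − w·μ∘[ℓ]` is
`ℓ`-old with `μ` periodic and `T_q`-eigen (eigenvalue `e_q`, `χ(q)e_q ≡ a_q(W)`, `q` invertible mod
`m`, `χ(q)² = 1`) at the Kolyvagin primes of `(W, p)`, `ℓ` invertible mod `m`, `χ(ℓ)² = 1`,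
`w·χ(ℓ) = 1`, then `PlusSymbolLevelLowersAt W p f_W ℓ` (witness `c·T_χμ`; part 4 §1). The case
`φ` = reduced PLUS symbol of `f_V` is part 4's `plusSymbolLevelLowersAt_of_twistSum`; `φ` = reduced
MINUS symbol is §2 below. [cite: Kim2022StructureSelmer, §1.2.2 and §1.4.3]
[cite: MazurTateTeitelbaum1986Invent, §I.4 (4.2) and §I.8] -/
theorem plusSymbolLevelLowersAt_of_twistSum_fn (c : ZMod p) (φ : ℚ → ZMod p)
    (hsym : ∀ r : ℚ, ((ratPlusSymbol fW r : ℚ) : ZMod p) =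
      c * ∑ u : ZMod m, χ u * φ (r + (u.val : ℚ) / m))
    {μ : ℚ → ZMod p} (hμ : IsPeriodic μ) {w : ZMod p} {ℓ : ℕ}
    (hV : ∀ r : ℚ, φ r = μ r - w * μ (ℓ * r))
    (hℓ : IsUnit ((ℓ : ℕ) : ZMod m)) (hχℓ : χ ℓ ^ 2 = 1) (hw : w * χ ℓ = 1)
    (e : ℕ → ZMod p)
    (hH : ∀ q : ℕ, Kato.IsKolyvaginPrime W p 1 q →
      HeckeRel μ q (e q) ∧ IsUnit ((q : ℕ) : ZMod m) ∧ χ q ^ 2 = 1 ∧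
        χ q * e q = (W.frobeniusTrace q : ZMod p)) :
    PlusSymbolLevelLowersAt W p fW ℓ := by
  refine ⟨fun r ↦ c * ∑ u : ZMod m, χ u * μ (r + (u.val : ℚ) / m), ?_, ?_, ?_⟩
  · intro r z
    have hper := isPeriodic_twistSum χ hμ r z
    simp only at hper ⊢
    rw [hper]
  · intro q hq
    obtain ⟨hHq, hqu, hχq, haq⟩ := hH q hq
    rw [← haq]
    exact heckeRel_const_mul' (heckeRel_twistSum χ hμ hq.prime.ne_zero hqu hχq hHq) c
  · intro r
    rw [hsym r, twistSum_oldform χ hμ hℓ hχℓ hV r, hw, one_mul, mul_sub]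

end TransportFn

/-! ### §2 The cell's case at `p ≡ 3 (mod 4)`: the MINUS symbol of `V` -/

section LegendreMinus

variable {p : ℕ} [hp : Fact p.Prime]

/-- Casting a `p`-integral product of rationals to `ℤ/p`. [folklore] -/
private theorem ratCast_mul_of_not_dvd' {a b : ℚ} (ha : ¬ p ∣ a.den) (hb : ¬ p ∣ b.den) :
    ((a * b : ℚ) : ZMod p) = (a : ZMod p) * (b : ZMod p) :=
  Rat.cast_mul_of_ne_zero (mt (ZMod.natCast_eq_zero_iff _ _).mp ha)
    (mt (ZMod.natCast_eq_zero_iff _ _).mp hb)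

/-- A sum of `p`-integral rationals is `p`-integral and casts termwise to `ℤ/p`. [folklore] -/
private theorem ratCast_sum_of_not_dvd' {ι : Type*} (s : Finset ι) (g : ι → ℚ)
    (h : ∀ i ∈ s, ¬ p ∣ (g i).den) :
    ¬ p ∣ (∑ i ∈ s, g i).den ∧ ((∑ i ∈ s, g i : ℚ) : ZMod p) = ∑ i ∈ s, ((g i : ℚ) : ZMod p) := by
  classical
  induction s using Finset.induction_on with
  | empty => simp [hp.out.one_lt.ne']
  | insert a s has ih =>
    have ha : ¬ p ∣ (g a).den := h a (Finset.mem_insert_self a s)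
    obtain ⟨hs, hcast⟩ := ih fun i hi ↦ h i (Finset.mem_insert_of_mem hi)
    rw [Finset.sum_insert has, Finset.sum_insert has]
    refine ⟨fun hd ↦ ?_, ?_⟩
    · have := hd.trans (Rat.add_den_dvd (g a) (∑ i ∈ s, g i))
      rcases (Nat.Prime.dvd_mul hp.out).mp this with h1 | h1
      · exact ha h1
      · exact hs h1
    · rw [Rat.cast_add_of_ne_zero (mt (ZMod.natCast_eq_zero_iff _ _).mp ha)
        (mt (ZMod.natCast_eq_zero_iff _ _).mp hs), hcast]

/-- The Legendre symbol mod `p` in `ℤ/p` as a monoid hom, evaluated. [folklore] -/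
private theorem legendreHom_apply' (u : ZMod p) :
    ((quadraticChar (ZMod p)).ringHomComp (Int.castRingHom (ZMod p))).toMonoidHom u =
      ((legendreSym p (u.val : ℤ) : ℤ) : ZMod p) := by
  rw [MulChar.coe_toMonoidHom, MulChar.ringHomComp_apply, legendreSym, Int.cast_natCast,
    ZMod.natCast_zmod_val]
  rfl

/-- `((n/p))² = 1` in `ℤ/p` for `p ∤ n`. [folklore] -/
private theorem legendreHom_sq_eq_one' {n : ℕ} (hn : ¬ p ∣ n) :
    ((quadraticChar (ZMod p)).ringHomComp (Int.castRingHom (ZMod p))).toMonoidHom (n : ZMod p) ^ 2 = 1 := by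
  have hn0 : (n : ZMod p) ≠ 0 := mt (ZMod.natCast_eq_zero_iff _ _).mp hn
  rw [MulChar.coe_toMonoidHom, MulChar.ringHomComp_apply, ← map_pow, quadraticChar_sq_one hn0]
  simp

/-- **THE CELL'S TRANSPORT AT `p ≡ 3 (mod 4)` (odd `χ_{p*}`; the whole `p = 3` block): the
certificate of `W = V ⊗ χ_{p*}` from the MINUS-symbol data of `V`.** Hypotheses: the ℚ-level identity
`[r]⁺_{f_W} = c₀ · ∑_{u mod p} (u/p) [r + u/p]⁻_{f_V}` with one `p`-integral constant (`hsym`: the shape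
of `ModularForms.exists_rat_forall_ratPlusSymbol_charTwist_eq_of_odd`; per pair `c₀ = ±1`);
`p`-integral minus symbols of `f_V` (`hint`); the `ℓ`-old identity of sign `w` for the reduced MINUS
symbol of `f_V` (`hV`, computed per pair in the sign `−1` modular symbols of level `N_V/ℓ`), `μ`
periodic and `T_q`-eigen with eigenvalue `a_q(V)` at the Kolyvagin primes of `(W, p)`, where
`a_q(W) ≡ (q/p)a_q(V)` (`haq`); `p ∤ ℓ`, `w·(ℓ/p) = 1`. Conclusion: `PlusSymbolLevelLowersAt W p f_W ℓ`,
hence all of part 3's consequences for `W`. [cite: Kim2022StructureSelmer, §1.2.2 and §1.4.3]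
[cite: MazurTateTeitelbaum1986Invent, §I.4 (4.2) and §I.8] -/
theorem plusSymbolLevelLowersAt_of_legendreTwist_minus (W V : WeierstrassCurve ℚ)
    [W.IsGloballyMinimal] [V.IsGloballyMinimal]
    {NW NV : ℕ} (fW : CuspForm (Gamma0 NW) 2) (fV : CuspForm (Gamma0 NV) 2)
    (c₀ : ℚ) (hc : ¬ p ∣ c₀.den) (hint : ∀ x : ℚ, ¬ p ∣ (ratMinusSymbol fV x).den)
    (hsym : ∀ r : ℚ, ratPlusSymbol fW r =
      c₀ * ∑ u : ZMod p, (legendreSym p (u.val : ℤ) : ℚ) * ratMinusSymbol fV (r + (u.val : ℚ) / p))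
    {μ : ℚ → ZMod p} (hμ : IsPeriodic μ) {w : ZMod p} {ℓ : ℕ} (hℓ : ¬ p ∣ ℓ)
    (hV : ∀ r : ℚ, ((ratMinusSymbol fV r : ℚ) : ZMod p) = μ r - w * μ (ℓ * r))
    (hw : w * ((legendreSym p (ℓ : ℤ) : ℤ) : ZMod p) = 1)
    (hHV : ∀ q : ℕ, Kato.IsKolyvaginPrime W p 1 q → HeckeRel μ q (V.frobeniusTrace q : ZMod p))
    (haq : ∀ q : ℕ, Kato.IsKolyvaginPrime W p 1 q →
      (W.frobeniusTrace q : ZMod p) = ((legendreSym p (q : ℤ) : ℤ) : ZMod p) * V.frobeniusTrace q) :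
    PlusSymbolLevelLowersAt W p fW ℓ := by
  haveI : NeZero p := ⟨hp.out.ne_zero⟩
  set χ : ZMod p →* ZMod p :=
    ((quadraticChar (ZMod p)).ringHomComp (Int.castRingHom (ZMod p))).toMonoidHom with hχdef
  have hχnat : ∀ n : ℕ, χ (n : ZMod p) = ((legendreSym p (n : ℤ) : ℤ) : ZMod p) := by
    intro n
    rw [hχdef, legendreHom_apply', ZMod.val_natCast, Int.natCast_mod, ← legendreSym.mod]
  set φ : ℚ → ZMod p := fun x ↦ ((ratMinusSymbol fV x : ℚ) : ZMod p) with hφdef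
  have hsymP : ∀ r : ℚ, ((ratPlusSymbol fW r : ℚ) : ZMod p) =
      (c₀ : ZMod p) * ∑ u : ZMod p, χ u * φ (r + (u.val : ℚ) / p) := by
    intro r
    have hterm : ∀ u ∈ (Finset.univ : Finset (ZMod p)),
        ¬ p ∣ ((legendreSym p (u.val : ℤ) : ℚ) * ratMinusSymbol fV (r + (u.val : ℚ) / p)).den := by
      intro u _ hd
      have := hd.trans (Rat.mul_den_dvd _ _)
      rw [Rat.den_intCast, one_mul] at this
      exact hint _ this
    obtain ⟨hden, hcast⟩ := ratCast_sum_of_not_dvd' (p := p) Finset.univ _ hterm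
    rw [hsym r, ratCast_mul_of_not_dvd' hc hden, hcast]
    congr 1
    refine Finset.sum_congr rfl fun u _ ↦ ?_
    rw [ratCast_mul_of_not_dvd' (by rw [Rat.den_intCast]; exact hp.out.one_lt.ne' ∘ Nat.dvd_one.mp)
      (hint _), Rat.cast_intCast, hχdef, legendreHom_apply']
  have hℓu : IsUnit ((ℓ : ℕ) : ZMod p) :=
    (ZMod.isUnit_iff_coprime ℓ p).mpr ((Nat.coprime_comm).mp ((Nat.Prime.coprime_iff_not_dvd hp.out).mpr hℓ))
  have hχℓ : χ ℓ ^ 2 = 1 := legendreHom_sq_eq_one' hℓ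
  have hw' : w * χ ℓ = 1 := by rwa [hχnat ℓ]
  refine plusSymbolLevelLowersAt_of_twistSum_fn W p χ fW (c₀ : ZMod p) φ hsymP hμ hV hℓu hχℓ hw'
    (fun q ↦ χ q * (W.frobeniusTrace q : ZMod p)) fun q hq ↦ ?_
  have hqp : ¬ p ∣ q := fun hd ↦
    hq.ne ((Nat.prime_dvd_prime_iff_eq hp.out hq.prime).mp hd).symm
  have hqu : IsUnit ((q : ℕ) : ZMod p) :=
    (ZMod.isUnit_iff_coprime q p).mpr ((Nat.coprime_comm).mp ((Nat.Prime.coprime_iff_not_dvd hp.out).mpr hqp))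
  have hχq : χ q ^ 2 = 1 := legendreHom_sq_eq_one' hqp
  refine ⟨?_, hqu, hχq, ?_⟩
  · have : χ q * (W.frobeniusTrace q : ZMod p) = (V.frobeniusTrace q : ZMod p) := by
      rw [haq q hq, ← hχnat q, ← mul_assoc, ← sq, hχq, one_mul]
    rw [this]
    exact hHV q hq
  · rw [← mul_assoc, ← sq, hχq, one_mul]

end LegendreMinus

/-! ### §3 Instrument lemma: the Kurihara numbers of `W` are twisted Kurihara sums on `V` -/

section KuriharaByTwist

variable {p : ℕ} [Fact p.Prime] {m : ℕ} [NeZero m] (χ : ZMod m →* ZMod p)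
  {NW : ℕ} (fW : CuspForm (Gamma0 NW) 2)

/-- **KURIHARA NUMBERS BY TWIST (instrument lemma).** Under the mod-`p` twist identity
`[r]⁺_{f_W} ≡ c · ∑_{u mod m} χ(u) φ(r + u/m)` (`φ` = the reduced plus or minus symbol of `f_V`),
every mod-`p` Kurihara number of `f_W` is `c` times the twisted Kurihara sum of `φ`:
`δ̃_n(f_W; ψ) = c · ∑_{a ∈ (ℤ/n)ˣ} (∑_{u mod m} χ(u) φ(a/n + u/m)) · ∏_{q ∣ n} ψ_q(a)` — so the
Kurihara numbers of the additive curve `W` are computed from the modular symbol of `V`, at level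
`N_V` (Kim §1.4.3, the tree's `kuriharaNumber`). [cite: Kim2022StructureSelmer, §1.4.3 (PDF p. 7)] -/
theorem kuriharaNumber_eq_twistSum (c : ZMod p) (φ : ℚ → ZMod p)
    (hsym : ∀ r : ℚ, ((ratPlusSymbol fW r : ℚ) : ZMod p) =
      c * ∑ u : ZMod m, χ u * φ (r + (u.val : ℚ) / m))
    (n : ℕ) [NeZero n] (ψ : (q : ℕ) → (ZMod q)ˣ →* Multiplicative (ZMod p)) :
    kuriharaNumber fW p n ψ =
      c * ∑ a : (ZMod n)ˣ, (∑ u : ZMod m, χ u * φ (((a : ZMod n).val : ℚ) / n + (u.val : ℚ) / m)) *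
        ∏ q ∈ n.primeFactors.attach,
          Multiplicative.toAdd (ψ q.1 (ZMod.unitsMap (Nat.dvd_of_mem_primeFactors q.2) a)) := by
  rw [kuriharaNumber_eq_sum_ratCast, Finset.mul_sum]
  refine Finset.sum_congr rfl fun a _ ↦ ?_
  rw [hsym, mul_assoc]

end KuriharaByTwist

end Summit.BirchSwinnertonDyer.Rank1Residual.LevelLowering

end
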